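/-
Origin: expansion seat `planner-pub-hodgecm-pv14-0`, handover v2 2026-08-18 (additive superset of run-20 copy 6b0644b8) (`HOME/pub-hodgecm-pv14/lean/Pv14/PerL34/P43Bridge.lean`, md5 e19f3b94, 152 lines);
landed by the gen-6 packager in gate run 22 REPLACES the earlier landed copy of `HodgeCM/PerL34/P43_bridge.lean` (verbatim).
-/
/-
Origin: HOME/pub-hodgecm-pv14/lean/Pv14/PerL34/P43Bridge.lean — session planner-pub-hodgecm-pv14-0 (unit pub-hodgecm-pv14,
DAG-NODE PROVER #14).  Intended final place: `HodgeCM/PerL34/P43_bridge.lean` (imports the two LANDED files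
`HodgeCM/PerL34/P43_forms.lean` (pv14, node N33b) and `HodgeCM/PerL34/P43_lineSpan.lean` (pv02, node N33c)).
DAG edge **N33b → N33c** made kernel-explicit: pv02's INPUT `LineSpanData.UHolomorphic` ("`u_f` is a holomorphic
one-form on `𝔹²`", tex ll. 650–655) and the (ii)-half of `N33b_statement` are CLOSED BY NAME from N33b's own inputs
(X1) `ThetaPKilledByPminus`, (X2) `HolomorphicOfPminus` and the theta-kernel model.  KERNEL glue only; nothing asserted.
-/
import Summits.HodgeConjecture.HodgeCM.PerL34.P43_forms
import Summits.HodgeConjecture.HodgeCM.PerL34.P43_lineSpan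

set_option autoImplicit false

/-!
# N33b → N33c bridge

pv02 (`HodgeCM.PerL34.P43.LineSpanData`, node N33c) takes node N33b's output as the INPUT
`UHolomorphic : ∀ i χ, ∀ F ∈ D.ThetaP i χ, uEval F ∈ D.Hol`.  pv14 (`HodgeCM.PerL34.P43Forms`, node N33b) proves
`N33b_holomorphic (hX1 : ThetaPKilledByPminus FD M) (hX2 : HolomorphicOfPminus FD) : ∀ F ∈ M.ThetaP, uEval F ∈ FD.Hol`.
The two function models coincide definitionally (`P43.uEval = P43Forms.uEval`, both `F ↦ (g ↦ F (g,1,1))`;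
likewise `rTransl`), so the INPUT is discharged once the spaces are matched: `FD.Hol = D.Hol` and, for each
`(i, χ'_i)`, a theta-kernel model `M i χ` with `(M i χ).ThetaP = D.ThetaP i χ` (or directly the slice form of (X1)).

* `uEval_eq`, `rTransl_eq` — the two models agree (`rfl`);
* `UHolomorphic_of_slices` — `UHolomorphic` from (X1) stated slice-wise on pv02's `ThetaP i χ` and (X2);
* `UHolomorphic_of_N33b` — `UHolomorphic` from pv14's `N33b_holomorphic` through theta-kernel models `M i χ`;
* `FiniteStable_of_N33b`, `CompactInvariant_of_N33b`, `LeftInvariant_of_N33b` — pv02's other three INPUTs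
  (N09/N10 content, tex l. 654/656/660) from the theta-kernel model's DEFINITIONAL hypotheses
  (`ThetaKernelData.thetaP_finiteStable`, `thetaP_compactInvariant'`, `LeftInvariant`);
* `N33c_of_N33b` — pv02's `N33c_statement` from N33b's inputs + pv02's `SomeNonzero` (N30/N33a), end to end.
-/

namespace HodgeCM
namespace PerL34
namespace P43Bridge

open HodgeCM.PerL34

section Models

variable {Ginf Gc Gf V : Type*} [Group Ginf] [Group Gc] [Group Gf] [AddCommGroup V] [Module ℂ V]

omit [Group Ginf] in
/-- The evaluation maps `u_f(g) = F_f(g,1,1)` of the two files are the same map. -/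
theorem uEval_eq : (P43.uEval : (Ginf × Gc × Gf → V) →ₗ[ℂ] (Ginf → V)) = P43Forms.uEval := rfl

omit [Group Ginf] [Group Gc] in
/-- The right translations `R(h_f)` of the two files are the same map. -/
theorem rTransl_eq (h : Gf) :
    (P43.rTransl h : (Ginf × Gc × Gf → V) →ₗ[ℂ] (Ginf × Gc × Gf → V)) = P43Forms.rTransl h := rfl

end Models

variable (D : P43.LineSpanData)

/-- **`UHolomorphic` from (X1) slice-wise + (X2).**  `FD` is the `(𝔤,K)`/holomorphic-forms dictionary on
`U(2,1)` with the SAME space of holomorphic one-forms as pv02's datum. -/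
theorem UHolomorphic_of_slices (FD : P43Forms.FormsDictionary D.Ginf D.V) (hHol : FD.Hol = D.Hol)
    (hX1 : ∀ (i : Fin 2) (χ : D.X i), ∀ F ∈ D.ThetaP i χ,
      P43Forms.uEval F ∈ FD.Cochain ∧ ∀ X ∈ FD.Pminus, X (P43Forms.uEval F) = 0)
    (hX2 : P43Forms.HolomorphicOfPminus FD) : D.UHolomorphic := by
  intro i χ F hF
  have h : P43Forms.uEval F ∈ FD.Hol := hX2 _ (hX1 i χ F hF).1 (hX1 i χ F hF).2
  rw [hHol] at h
  exact h

/-- **`UHolomorphic` (pv02's N33b-INPUT) from pv14's `N33b_holomorphic`**, through one theta-kernel model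
`M i χ` per fixed line and character with `(M i χ).ThetaP = Θ_i(χ'_i)[𝔭₊]`. -/
theorem UHolomorphic_of_N33b (FD : P43Forms.FormsDictionary D.Ginf D.V) (hHol : FD.Hol = D.Hol)
    (S : (i : Fin 2) → D.X i → Type) [∀ i χ, AddCommGroup (S i χ)] [∀ i χ, Module ℂ (S i χ)]
    (M : (i : Fin 2) → (χ : D.X i) → P43Forms.ThetaKernelData D.Ginf D.Gc D.Gf D.V (S i χ))
    (hM : ∀ i χ, (M i χ).ThetaP = D.ThetaP i χ)
    (hX1 : ∀ i χ, P43Forms.ThetaPKilledByPminus FD (M i χ)) (hX2 : P43Forms.HolomorphicOfPminus FD) :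
    D.UHolomorphic := by
  intro i χ F hF
  have hF' : F ∈ (M i χ).ThetaP := by rw [hM]; exact hF
  have h : P43Forms.uEval F ∈ FD.Hol := P43Forms.N33b_holomorphic FD (M i χ) (hX1 i χ) hX2 hF'
  rw [hHol] at h
  exact h

/-- **`FiniteStable` (pv02's INPUT from N10, used at tex l. 656/660) from the theta-kernel model**: stability of
`Θ_i(χ'_i)[𝔭₊]` under `R(h_f)` is `ThetaKernelData.thetaP_finiteStable` (equivariance `θ(ω(h_f)φ) = R(h_f)θ(φ)`
and `ω(h_f)` preserves the type `𝔭₊ ⊠ 𝟏`), i.e. the membership half of N33b (ii). -/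
theorem FiniteStable_of_N33b
    (S : (i : Fin 2) → D.X i → Type) [∀ i χ, AddCommGroup (S i χ)] [∀ i χ, Module ℂ (S i χ)]
    (M : (i : Fin 2) → (χ : D.X i) → P43Forms.ThetaKernelData D.Ginf D.Gc D.Gf D.V (S i χ))
    (hM : ∀ i χ, (M i χ).ThetaP = D.ThetaP i χ)
    (hθf : ∀ i χ, (M i χ).ThetaEquivariantF) (hPf : ∀ i χ, (M i χ).PtypeStableF) :
    D.FiniteStable := by
  intro i χ h F hF
  have hF' : F ∈ (M i χ).ThetaP := by rw [hM]; exact hF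
  have hmem : P43Forms.rTransl h F ∈ (M i χ).ThetaP := (M i χ).thetaP_finiteStable (hθf i χ) (hPf i χ) h hF'
  rw [hM] at hmem
  exact hmem

/-- **`CompactInvariant` (pv02's INPUT from N09, tex l. 654 "f is invariant under the compact factors") from the
theta-kernel model**: `ThetaKernelData.thetaP_compactInvariant'` (equivariance under `G_c` + the type `𝟏` at
`b ≠ ι₁` is fixed by `ω(G_c)`). -/
theorem CompactInvariant_of_N33b
    (S : (i : Fin 2) → D.X i → Type) [∀ i χ, AddCommGroup (S i χ)] [∀ i χ, Module ℂ (S i χ)]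
    (M : (i : Fin 2) → (χ : D.X i) → P43Forms.ThetaKernelData D.Ginf D.Gc D.Gf D.V (S i χ))
    (hM : ∀ i χ, (M i χ).ThetaP = D.ThetaP i χ)
    (hθc : ∀ i χ, (M i χ).ThetaEquivariantC) (hPc : ∀ i χ, (M i χ).PtypeFixedC) :
    D.CompactInvariant := by
  intro i χ F hF g c k
  have hF' : F ∈ (M i χ).ThetaP := by rw [hM]; exact hF
  exact (M i χ).thetaP_compactInvariant' (hθc i χ) (hPc i χ) hF' g c k

/-- **`LeftInvariant` (pv02's INPUT from N09/N10: theta functions live on `G_U(L₀)\G_U(𝔸)`)** is literally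
pv14's `ThetaKernelData.LeftInvariant` slice-wise. -/
theorem LeftInvariant_of_N33b
    (S : (i : Fin 2) → D.X i → Type) [∀ i χ, AddCommGroup (S i χ)] [∀ i χ, Module ℂ (S i χ)]
    (M : (i : Fin 2) → (χ : D.X i) → P43Forms.ThetaKernelData D.Ginf D.Gc D.Gf D.V (S i χ))
    (hM : ∀ i χ, (M i χ).ThetaP = D.ThetaP i χ) (hL : ∀ i χ, (M i χ).LeftInvariant D.Γ) :
    D.LeftInvariant := by
  intro i χ F hF γ hγ x
  have hF' : F ∈ (M i χ).ThetaP := by rw [hM]; exact hF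
  exact hL i χ F hF' γ hγ x

/-- **N33c from N33b's inputs** (the DAG edge, end to end): pv02's `N33c_statement` (𝒰_i ⊆ Hol, γ^*𝒰_i = 𝒰_i,
𝒰_i ≠ 0) from the theta-kernel models, the forms dictionary with (X1), (X2), and pv02's remaining INPUT
`SomeNonzero` (N30/N33a: some `Θ_i(χ'_i)[𝔭₊] ≠ 0`). -/
theorem N33c_of_N33b (FD : P43Forms.FormsDictionary D.Ginf D.V) (hHol : FD.Hol = D.Hol)
    (S : (i : Fin 2) → D.X i → Type) [∀ i χ, AddCommGroup (S i χ)] [∀ i χ, Module ℂ (S i χ)]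
    (M : (i : Fin 2) → (χ : D.X i) → P43Forms.ThetaKernelData D.Ginf D.Gc D.Gf D.V (S i χ))
    (hM : ∀ i χ, (M i χ).ThetaP = D.ThetaP i χ)
    (hL : ∀ i χ, (M i χ).LeftInvariant D.Γ)
    (hθc : ∀ i χ, (M i χ).ThetaEquivariantC) (hPc : ∀ i χ, (M i χ).PtypeFixedC)
    (hθf : ∀ i χ, (M i χ).ThetaEquivariantF) (hPf : ∀ i χ, (M i χ).PtypeStableF)
    (hX1 : ∀ i χ, P43Forms.ThetaPKilledByPminus FD (M i χ)) (hX2 : P43Forms.HolomorphicOfPminus FD)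
    (hne : D.SomeNonzero) : D.N33c_statement :=
  D.N33c_of (LeftInvariant_of_N33b D S M hM hL) (CompactInvariant_of_N33b D S M hM hθc hPc)
    (FiniteStable_of_N33b D S M hM hθf hPf) (UHolomorphic_of_N33b D FD hHol S M hM hX1 hX2) hne

/-- **pv03's `BallSpanModel.GroupInputs` conjunction** (`BallSpans.lean` :237, in this order:
`LeftInvariant ∧ CompactInvariant ∧ FiniteStable ∧ UHolomorphic ∧ SomeNonzero`) for a `LineSpanData` from the
theta-kernel models of N33b, the forms dictionary with (X1), (X2), and `SomeNonzero` (N30/N33a). For pv03's `M`,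
`M.GroupInputs` is this statement at `D := M.toLineSpans.D` (by `exact`). -/
theorem groupInputs_of_N33b (FD : P43Forms.FormsDictionary D.Ginf D.V) (hHol : FD.Hol = D.Hol)
    (S : (i : Fin 2) → D.X i → Type) [∀ i χ, AddCommGroup (S i χ)] [∀ i χ, Module ℂ (S i χ)]
    (M : (i : Fin 2) → (χ : D.X i) → P43Forms.ThetaKernelData D.Ginf D.Gc D.Gf D.V (S i χ))
    (hM : ∀ i χ, (M i χ).ThetaP = D.ThetaP i χ)
    (hL : ∀ i χ, (M i χ).LeftInvariant D.Γ)
    (hθc : ∀ i χ, (M i χ).ThetaEquivariantC) (hPc : ∀ i χ, (M i χ).PtypeFixedC)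
    (hθf : ∀ i χ, (M i χ).ThetaEquivariantF) (hPf : ∀ i χ, (M i χ).PtypeStableF)
    (hX1 : ∀ i χ, P43Forms.ThetaPKilledByPminus FD (M i χ)) (hX2 : P43Forms.HolomorphicOfPminus FD)
    (hne : D.SomeNonzero) :
    D.LeftInvariant ∧ D.CompactInvariant ∧ D.FiniteStable ∧ D.UHolomorphic ∧ D.SomeNonzero :=
  ⟨LeftInvariant_of_N33b D S M hM hL, CompactInvariant_of_N33b D S M hM hθc hPc,
    FiniteStable_of_N33b D S M hM hθf hPf, UHolomorphic_of_N33b D FD hHol S M hM hX1 hX2, hne⟩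

end P43Bridge
end PerL34
end HodgeCM
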